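import Literature.Topology.FourManifolds.LatticeFormsPolarisationTypesOrthogonalOrbits
import HarnessLib

/-!
# The stabiliser of a polarisation vector acts on `D(L_{2t})` by `x ↦ sx` with `s ≡ 1 (mod div h)`; hence
# `O(L_{2t}, h_d) = Õ(L_{2t}, h_d)` for `div(h_d) = 2t`, and for `div(h_d) = t` odd
# (Gritsenko–Hulek–Sankaran, *Compositio Math.* 146 (2010), §4 Cor. 4.13)

Trunk T-4MAN vocabulary; sequel of `LatticeFormsPolarisationTypesOrthogonalOrbits.lean` (row g44-#1: for `L = B₀ ⊕ ⟨−2t⟩`,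
`B₀` even unimodular, every `g ∈ O(L)` acts on the cyclic group `A_L` as a homothety `x ↦ sx` with `s² ≡ 1 (mod 4t)`
(`exists_int_discriminantGroupCongr_eq_zsmul`), two homotheties agree iff `s ≡ s' (mod 2t)`
(`forall_zsmul_eq_zsmul_iff_prod_neg_twoMul`), and `ḡ = (x ↦ sx)` multiplies the `l_t`-coordinate by `s` modulo the divisor
(`dvd_snd_apply_sub_mul_snd_of_discriminantGroupCongr_eq_zsmul`)) and of `LatticeFormsPolarisationTypesGeneralDivisor.lean`
(g43: `gcd_snd_eq_one_of_primitive_of_forall_dvd`, "`c` is coprime to `f` because `h_d` is primitive"). Written for lane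
`lit-hodgefound` (Track 2 foundations; prover seat `lit-hodgefound-p18`, gen 44, row g44-#11). THEOREMS ONLY — no definition,
no named fact, no instance, no notation.

## Source, verbatim (V. Gritsenko, K. Hulek, G. K. Sankaran, Compositio Math. 146 (2010) 404–434, arXiv numbering §4,
held text `paper:arxiv-0802.2078` pp. 11–13)

"**Corollary 4.7.** […] *Proof.* The natural projection `O(L_{2t}) → O(D(L_{2t}))` is surjective (see [Nik]). Furthermore
(see [GH]) `O(D(L_{2t})) ≅ {x mod 2t ∣ x² ≡ 1 mod 4t}`. […]" "**Proposition 4.12.** Let `h_d ∈ L_{2t}` be a primitive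
vector such that `h_d² = 2d` and `div(h_d) = f`. Assume that `w = 1` […] (ii) The factor group `O(L_{2t}, h_d)/Õ(L_{2t}, h_d)`
is an abelian `2`-group, which is of order `2^{ρ(t/f)}` if `f` is odd. If `f` is even the order is equal to
`2^{ρ(2t/f)+δ}` […]" "**Corollary 4.13.** We have that `O(L_{2t}, h_d) ≅ Õ(L_{2t}, h_d)` in the following three cases: `f`
is odd and `f = t`; or `f = 2t`; or `f = t` and `2d/f` is odd. *Proof.* If `f = t` or `f = 2t`, then
`g = (2t/f, 2d/f) = 1` or `2`. If `g = 1`, then `w = 1`. If `g = 2` then `w = (f, g) = 1` for odd `f` and for even `f` such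
that `(2d)/f` is odd. In all these case the index `[O(L_{2t}, h_d) : Õ(L_{2t}, h_d)] = 1` according Proposition 4.12. □"
(Notation of §4: `L_{2t} = 3U ⊕ 2E₈(−1) ⊕ ⟨−2t⟩`, `l_t` a generator of `⟨−2t⟩`, `h_d = fv + cl_t` with `(c, f) = 1`,
`Õ(L) = ker(O(L) → O(D(L)))`, `O(L, h)` the stabiliser of `h`.)

## Reading notes

* ABSTRACTION as in the predecessor files: `L = B₀ ⊕ ⟨−2t⟩` with `B₀` symmetric even unimodular (`3U ⊕ 2E₈(−1)` is the
  printed `B₀`), `t ≥ 1`; "`div(h) = f`" enters only as "`f ∣ (h, z)` for all `z`" together with primitivity (`h ≠ 0`,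
  `ℤh` saturated), which already forces `(c, f) = 1` for the `l_t`-coordinate `c = h.2`; no group structure is declared,
  so "`O(L_{2t}, h_d) ≅ Õ(L_{2t}, h_d)`" (an inclusion of a subgroup being an equality) is rendered as: every isometry
  `g` of `L` with `g h = h` acts as the identity on `A_L` (`ḡ = id`, the tree's membership in `Õ`).
* THE PROOF HERE IS NOT THE PRINTED ONE. GHS deduce Cor. 4.13 from the order formula of Prop. 4.12 (ii), whose general-`f`
  case is not in the tree (only `f = 1`, `LatticeFormsDivisorOneStabiliserQuotient.lean`). Instead (§1–§2): by the proof of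
  Cor. 4.7, `ḡ` is a homothety `x ↦ sx` of `A_L ≅ ℤ/2t` with `s² ≡ 1 (mod 4t)`; `ḡ` multiplies the `l_t`-coordinate by `s`
  modulo `f` (row g44-#1 §4), so `g h = h` gives `f ∣ (s − 1)c`, i.e. `s ≡ 1 (mod f)` as `(c, f) = 1`. For `f = 2t` this is
  `ḡ = id` outright; for `f = t` odd, `s² ≡ 1 (mod 4)` makes `s` odd, so `2t ∣ s − 1` and again `ḡ = id`.
* THE THIRD PRINTED CASE "`f = t` and `2d/f` odd" IS VACUOUS in `L_{2t}` (and in every `B₀ ⊕ ⟨−2t⟩` with `B₀` even): if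
  `t ∣ (h, L)` then `h = tv + cl_t` and `2d = h² = t²v² − 2tc²` with `v²` even, so `2d/t = tv² − 2c²` is even (§3,
  `two_mul_dvd_apply_self_of_forall_dvd`). It is recorded, not used.

## Contents (all proved)

* §1 `dvd_sub_one_of_apply_eq_of_discriminantGroupCongr_eq_zsmul` (`g h = h`, `ḡ = (x ↦ sx)`, `f ∣ (h, L)`, `(f, c) = 1` ⟹
  `f ∣ s − 1`), **`exists_int_discriminantGroupCongr_eq_zsmul_of_apply_eq`** (the stabiliser of a primitive `h` with
  `f ∣ (h, L)` acts on `A_L` by `x ↦ sx` with `s² ≡ 1 (mod 4t)` AND `s ≡ 1 (mod f)`).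
* §2 Cor. 4.13: **`discriminantGroupCongr_eq_refl_of_apply_eq_of_forall_two_mul_dvd`** (`f = 2t`: `g h = h ⟹ ḡ = id`) and
  **`discriminantGroupCongr_eq_refl_of_apply_eq_of_forall_dvd_of_odd`** (`f = t` odd: `g h = h ⟹ ḡ = id`).
* §3 `two_mul_dvd_apply_self_of_forall_dvd` (`t ∣ (h, L) ⟹ 2t ∣ h²`: the third printed case does not occur).
* §4 the models `(E₈(−1)^{⊕m} ⊕ U^{⊕k}) ⊕ ℤ(−2t)` (`L_{2t}`: `m = 2`, `k = 3`; the `Kumⁿ` lattice: `m = 0`, `k = 3`).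

## References

* [GritsenkoHulekSankaran2010Symplectic] V. Gritsenko, K. Hulek, G. K. Sankaran, Moduli spaces of irreducible symplectic
  manifolds, Compositio Math. 146 (2010) 404–434 (arXiv:0802.2078): §4 Cor. 4.13 with its proof, proof of Cor. 4.7,
  Prop. 4.12 (ii).
* [GritsenkoHulek1998] V. Gritsenko, K. Hulek, Minimal Siegel modular threefolds, Math. Proc. Cambridge Philos. Soc. 123
  (1998) 461–485 (GHS's [GH]: `O(D(L_{2t})) ≅ {x mod 2t ∣ x² ≡ 1 mod 4t}`).
-/

noncomputable section

open Module Function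
open LinearMap (BilinForm)
open LinearMap.BilinForm

namespace Literature.Topology.FourManifolds

universe u

/-! ### §1 The stabiliser of `h` acts on `A_L` by `x ↦ sx` with `s ≡ 1 (mod div h)` -/

section Stabiliser

variable {M : Type u} [AddCommGroup M] [Module.Finite ℤ M] [Module.Free ℤ M] {B₀ : BilinForm ℤ M} (t : ℕ)

/-- If `g ∈ O(B₀ ⊕ ⟨−2t⟩)` fixes `h`, acts on `A_L` as `x ↦ sx`, and `f ∣ (h, z)` for all `z` with `(f, c) = 1` for the
`l_t`-coordinate `c` of `h`, then **`s ≡ 1 (mod f)`**: `ḡ` multiplies `c` by `s` modulo `f` and `g h = h`. (`B₀` unimodular,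
`t ≥ 1`, `f ≠ 0`.) [cite: GritsenkoHulekSankaran2010Symplectic, §4 proof of Cor. 4.7 and of Prop. 4.6 ("`h_d^* ≡ (c/f) l_t mod L_{2t}`")] -/
theorem dvd_sub_one_of_apply_eq_of_discriminantGroupCongr_eq_zsmul (hu : B₀.IsUnimodular) (ht : 0 < t)
    (g : (B₀.prod ((-(2 * t : ℤ)) • LinearMap.mul ℤ ℤ)).IsometryEquiv (B₀.prod ((-(2 * t : ℤ)) • LinearMap.mul ℤ ℤ)))
    {s : ℤ} (hg : ∀ a, g.discriminantGroupCongr a = s • a) {r : M × ℤ} {f : ℤ} (hf0 : f ≠ 0)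
    (hfr : ∀ z, f ∣ B₀.prod ((-(2 * t : ℤ)) • LinearMap.mul ℤ ℤ) r z) (hc : Int.gcd f r.2 = 1) (hgr : g r = r) :
    f ∣ s - 1 := by
  have h1 := dvd_snd_apply_sub_mul_snd_of_discriminantGroupCongr_eq_zsmul t hu ht g hg hf0 hfr
  rw [hgr, show r.2 - s * r.2 = (1 - s) * r.2 by ring] at h1
  have h2 : f ∣ 1 - s := Int.dvd_of_dvd_mul_left_of_gcd_one h1 hc
  rwa [← dvd_neg, neg_sub] at h2

/-- **The stabiliser `O(L, h)` of a primitive `h ∈ L = B₀ ⊕ ⟨−2t⟩` with `f ∣ (h, L)` acts on `A_L ≅ ℤ/2t` by homotheties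
`x ↦ sx` with `s² ≡ 1 (mod 4t)` and `s ≡ 1 (mod f)`** ("`O(D(L_{2t})) ≅ {x mod 2t ∣ x² ≡ 1 mod 4t}`" cut down by `g h = h`:
`g` fixes the class `h/f ≡ (c/f) l_t` of `A_L`, and `(c, f) = 1`). `B₀` symmetric even unimodular, `t ≥ 1`, `f ≠ 0`.
[cite: GritsenkoHulekSankaran2010Symplectic, §4 proof of Cor. 4.7, proof of Prop. 4.6, Cor. 4.13] [cite: GritsenkoHulek1998, (cited as [GH])] -/
theorem exists_int_discriminantGroupCongr_eq_zsmul_of_apply_eq (hu : B₀.IsUnimodular) (hs₀ : B₀.IsSymm) (he : B₀.IsEven)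
    (ht : 0 < t)
    (g : (B₀.prod ((-(2 * t : ℤ)) • LinearMap.mul ℤ ℤ)).IsometryEquiv (B₀.prod ((-(2 * t : ℤ)) • LinearMap.mul ℤ ℤ)))
    {r : M × ℤ} {f : ℤ} (hf0 : f ≠ 0) (hr0 : r ≠ 0) (hsat : ∀ (k : ℤ) (w : M × ℤ), k ≠ 0 → k • w ∈ ℤ ∙ r → w ∈ ℤ ∙ r)
    (hfr : ∀ z, f ∣ B₀.prod ((-(2 * t : ℤ)) • LinearMap.mul ℤ ℤ) r z) (hgr : g r = r) :
    ∃ s : ℤ, (4 * t : ℤ) ∣ s ^ 2 - 1 ∧ f ∣ s - 1 ∧ ∀ a, g.discriminantGroupCongr a = s • a := by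
  haveI : Module.IsTorsionFree ℤ M := inferInstance
  obtain ⟨s, hs, hg⟩ := exists_int_discriminantGroupCongr_eq_zsmul t hu hs₀ he ht g
  exact ⟨s, hs, dvd_sub_one_of_apply_eq_of_discriminantGroupCongr_eq_zsmul t hu ht g hg hf0 hfr
    (gcd_snd_eq_one_of_primitive_of_forall_dvd t hu hr0 hsat hfr) hgr, hg⟩

end Stabiliser

/-! ### §2 Cor. 4.13: `O(L_{2t}, h_d) = Õ(L_{2t}, h_d)` for `div(h_d) = 2t`, and for `div(h_d) = t` odd -/

section Corollary

variable {M : Type u} [AddCommGroup M] [Module.Finite ℤ M] [Module.Free ℤ M] {B₀ : BilinForm ℤ M} (t : ℕ)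

/-- **Cor. 4.13, case `f = 2t`: `O(L_{2t}, h_d) ≅ Õ(L_{2t}, h_d)`** — every isometry of `L = B₀ ⊕ ⟨−2t⟩` fixing a primitive `h`
with `2t ∣ (h, z)` for all `z` acts as the identity on `A_L` (`s ≡ 1 (mod 2t)` is `ḡ = id`). `B₀` symmetric even unimodular,
`t ≥ 1`. [cite: GritsenkoHulekSankaran2010Symplectic, §4 Cor. 4.13 (case "`f = 2t`")] -/
theorem discriminantGroupCongr_eq_refl_of_apply_eq_of_forall_two_mul_dvd (hu : B₀.IsUnimodular) (hs₀ : B₀.IsSymm)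
    (he : B₀.IsEven) (ht : 0 < t)
    (g : (B₀.prod ((-(2 * t : ℤ)) • LinearMap.mul ℤ ℤ)).IsometryEquiv (B₀.prod ((-(2 * t : ℤ)) • LinearMap.mul ℤ ℤ)))
    {r : M × ℤ} (hr0 : r ≠ 0) (hsat : ∀ (k : ℤ) (w : M × ℤ), k ≠ 0 → k • w ∈ ℤ ∙ r → w ∈ ℤ ∙ r)
    (hfr : ∀ z, (2 * t : ℤ) ∣ B₀.prod ((-(2 * t : ℤ)) • LinearMap.mul ℤ ℤ) r z) (hgr : g r = r) :
    g.discriminantGroupCongr = LinearEquiv.refl ℤ _ := by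
  obtain ⟨s, -, hf, hg⟩ := exists_int_discriminantGroupCongr_eq_zsmul_of_apply_eq t hu hs₀ he ht g (by positivity) hr0
    hsat hfr hgr
  have h1 := (forall_zsmul_eq_zsmul_iff_prod_neg_twoMul t hu s 1).2 hf
  exact LinearEquiv.ext fun a ↦ by rw [hg, h1, one_smul, LinearEquiv.refl_apply]

/-- **Cor. 4.13, case `f = t` odd: `O(L_{2t}, h_d) ≅ Õ(L_{2t}, h_d)`** — for odd `t`, every isometry of `L = B₀ ⊕ ⟨−2t⟩` fixing
a primitive `h` with `t ∣ (h, z)` for all `z` acts as the identity on `A_L` (`s ≡ 1 (mod t)` and `s² ≡ 1 (mod 4)` give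
`s ≡ 1 (mod 2t)`). `B₀` symmetric even unimodular. [cite: GritsenkoHulekSankaran2010Symplectic, §4 Cor. 4.13 (case "`f` is odd and `f = t`")] -/
theorem discriminantGroupCongr_eq_refl_of_apply_eq_of_forall_dvd_of_odd (hu : B₀.IsUnimodular) (hs₀ : B₀.IsSymm)
    (he : B₀.IsEven) (hto : Odd t)
    (g : (B₀.prod ((-(2 * t : ℤ)) • LinearMap.mul ℤ ℤ)).IsometryEquiv (B₀.prod ((-(2 * t : ℤ)) • LinearMap.mul ℤ ℤ)))
    {r : M × ℤ} (hr0 : r ≠ 0) (hsat : ∀ (k : ℤ) (w : M × ℤ), k ≠ 0 → k • w ∈ ℤ ∙ r → w ∈ ℤ ∙ r)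
    (hfr : ∀ z, (t : ℤ) ∣ B₀.prod ((-(2 * t : ℤ)) • LinearMap.mul ℤ ℤ) r z) (hgr : g r = r) :
    g.discriminantGroupCongr = LinearEquiv.refl ℤ _ := by
  have ht : 0 < t := hto.pos
  obtain ⟨s, hs, hf, hg⟩ := exists_int_discriminantGroupCongr_eq_zsmul_of_apply_eq t hu hs₀ he ht g
    (by exact_mod_cast ht.ne') hr0 hsat hfr hgr
  -- `s² ≡ 1 (mod 4)` ⟹ `s` odd ⟹ `2 ∣ s − 1`; with `t ∣ s − 1`, `t` odd: `2t ∣ s − 1`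
  have h2 : (2 : ℤ) ∣ s - 1 := by
    have h4 : (2 : ℤ) ∣ s ^ 2 - 1 := (dvd_mul_of_dvd_left (by norm_num : (2 : ℤ) ∣ 4) t).trans hs
    have hso : Odd s := by
      by_contra hse
      rw [Int.not_odd_iff_even] at hse
      obtain ⟨k, hk⟩ := hse
      obtain ⟨m, hm⟩ := h4
      have : s ^ 2 - 1 = 2 * (2 * k * k) - 1 := by rw [hk]; ring
      omega
    obtain ⟨k, hk⟩ := hso
    exact ⟨k, by rw [hk]; ring⟩
  have hcop : IsCoprime (2 : ℤ) t := by
    obtain ⟨k, hk⟩ := hto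
    exact ⟨-(k : ℤ), 1, by rw [hk]; push_cast; ring⟩
  have h2t : (2 * t : ℤ) ∣ s - 1 := hcop.mul_dvd h2 hf
  have h1 := (forall_zsmul_eq_zsmul_iff_prod_neg_twoMul t hu s 1).2 h2t
  exact LinearEquiv.ext fun a ↦ by rw [hg, h1, one_smul, LinearEquiv.refl_apply]

end Corollary

/-! ### §3 The third printed case "`f = t` and `2d/f` odd" does not occur: `t ∣ (h, L) ⟹ 2t ∣ h²` -/

section Vacuous

variable {M : Type u} [AddCommGroup M] {B₀ : BilinForm ℤ M} (t : ℕ)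

/-- If `t ∣ (h, z)` for all `z` in `L = B₀ ⊕ ⟨−2t⟩` (`B₀` even unimodular), then `h = tv + cl_t` and
`h² = t·(tv² − 2c²)` with `v²` even, so **`2t ∣ h²`**: the quotient `2d/f`, `f = t`, of Cor. 4.13's third case is always
even. [cite: GritsenkoHulekSankaran2010Symplectic, §4 Cor. 4.13 (case "`f = t` and `2d/f` is odd") and proof of Prop. 4.6 ("`2d = 2bf² − 2c²t`")] -/
theorem two_mul_dvd_apply_self_of_forall_dvd (hu : B₀.IsUnimodular) (he : B₀.IsEven) {r : M × ℤ}
    (hfr : ∀ z, (t : ℤ) ∣ B₀.prod ((-(2 * t : ℤ)) • LinearMap.mul ℤ ℤ) r z) :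
    (2 * t : ℤ) ∣ B₀.prod ((-(2 * t : ℤ)) • LinearMap.mul ℤ ℤ) r r := by
  obtain ⟨v, hv⟩ := exists_fst_eq_smul_of_forall_dvd t hu hfr
  obtain ⟨k, hk⟩ := he v
  rw [prod_neg_twoMul_smul_mul_apply, hv]
  simp only [map_smul, LinearMap.smul_apply, smul_eq_mul, hk]
  exact ⟨t * k - r.2 * r.2, by ring⟩

end Vacuous

/-! ### §4 The models `(E₈(−1)^{⊕m} ⊕ U^{⊕k}) ⊕ ℤ(−2t)` (`L_{2t}`: `m = 2`, `k = 3`; the `Kumⁿ` lattice: `m = 0`, `k = 3`) -/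

section Model

variable (m k t : ℕ)

/-- **Cor. 4.13 (`f = 2t`) in the models**: an isometry of `(E₈(−1)^{⊕m} ⊕ U^{⊕k}) ⊕ ℤ(−2t)` fixing a primitive `h` with
`2t ∣ (h, L)` acts trivially on the discriminant group. [cite: GritsenkoHulekSankaran2010Symplectic, §4 Cor. 4.13] -/
theorem discriminantGroupCongr_eq_refl_of_apply_eq_of_forall_two_mul_dvd_model (ht : 0 < t)
    (g : (((LinearMap.BilinForm.pi fun _ : Fin m ↦ -e8Form).prod (hyperbolicSum k)).prod
        ((-(2 * t : ℤ)) • LinearMap.mul ℤ ℤ)).IsometryEquiv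
      (((LinearMap.BilinForm.pi fun _ : Fin m ↦ -e8Form).prod (hyperbolicSum k)).prod ((-(2 * t : ℤ)) • LinearMap.mul ℤ ℤ)))
    {r : ((Fin m → Fin 8 → ℤ) × ((Fin k → ℤ) × (Fin k → ℤ))) × ℤ} (hr0 : r ≠ 0)
    (hsat : ∀ (a : ℤ) (w : ((Fin m → Fin 8 → ℤ) × ((Fin k → ℤ) × (Fin k → ℤ))) × ℤ), a ≠ 0 → a • w ∈ ℤ ∙ r → w ∈ ℤ ∙ r)
    (hfr : ∀ z, (2 * t : ℤ) ∣ (((LinearMap.BilinForm.pi fun _ : Fin m ↦ -e8Form).prod (hyperbolicSum k)).prod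
      ((-(2 * t : ℤ)) • LinearMap.mul ℤ ℤ)) r z) (hgr : g r = r) :
    g.discriminantGroupCongr = LinearEquiv.refl ℤ _ := by
  obtain ⟨hsB, heB, huB⟩ := isSymm_isEven_isUnimodular_pi_neg_e8Form_prod_hyperbolicSum' m k
  exact discriminantGroupCongr_eq_refl_of_apply_eq_of_forall_two_mul_dvd t huB hsB heB ht g hr0 hsat hfr hgr

/-- **Cor. 4.13 (`f = t` odd) in the models**: for odd `t`, an isometry of `(E₈(−1)^{⊕m} ⊕ U^{⊕k}) ⊕ ℤ(−2t)` fixing a primitive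
`h` with `t ∣ (h, L)` acts trivially on the discriminant group. [cite: GritsenkoHulekSankaran2010Symplectic, §4 Cor. 4.13] -/
theorem discriminantGroupCongr_eq_refl_of_apply_eq_of_forall_dvd_of_odd_model (hto : Odd t)
    (g : (((LinearMap.BilinForm.pi fun _ : Fin m ↦ -e8Form).prod (hyperbolicSum k)).prod
        ((-(2 * t : ℤ)) • LinearMap.mul ℤ ℤ)).IsometryEquiv
      (((LinearMap.BilinForm.pi fun _ : Fin m ↦ -e8Form).prod (hyperbolicSum k)).prod ((-(2 * t : ℤ)) • LinearMap.mul ℤ ℤ)))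
    {r : ((Fin m → Fin 8 → ℤ) × ((Fin k → ℤ) × (Fin k → ℤ))) × ℤ} (hr0 : r ≠ 0)
    (hsat : ∀ (a : ℤ) (w : ((Fin m → Fin 8 → ℤ) × ((Fin k → ℤ) × (Fin k → ℤ))) × ℤ), a ≠ 0 → a • w ∈ ℤ ∙ r → w ∈ ℤ ∙ r)
    (hfr : ∀ z, (t : ℤ) ∣ (((LinearMap.BilinForm.pi fun _ : Fin m ↦ -e8Form).prod (hyperbolicSum k)).prod
      ((-(2 * t : ℤ)) • LinearMap.mul ℤ ℤ)) r z) (hgr : g r = r) :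
    g.discriminantGroupCongr = LinearEquiv.refl ℤ _ := by
  obtain ⟨hsB, heB, huB⟩ := isSymm_isEven_isUnimodular_pi_neg_e8Form_prod_hyperbolicSum' m k
  exact discriminantGroupCongr_eq_refl_of_apply_eq_of_forall_dvd_of_odd t huB hsB heB hto g hr0 hsat hfr hgr

end Model

end Literature.Topology.FourManifolds
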